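import Summits.KontsevichZagierPeriods.KontsevichZagierPeriods.Theorems.FermatIsogenyBetaProductSectorStubQuadStepChart
import Literature.NumberTheory.Transcendental.KZProductIdeal
import Literature.NumberTheory.Transcendental.KZDominatedFamilyRelations
import Summits.KontsevichZagierPeriods.KontsevichZagierPeriods.Theorems.GrothendieckGpcLegendreLemniscaticStubFibration

/-!
# `BetaProductSector` (stmt-KontsevichZagierPeriods-3898), line `registered` (v3) — stub `stub_quadStep`,
# part 2: the two-dimensional core of the quadratic move

The core of the QUADRATIC MOVE "QUAD" (`B(x,y)·B(x+½,y) = 2·B(2x,2y)·B(½,y)`, Andrews–Askey–Roy 1999 Thm 3.1.3)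
inside the Kontsevich–Zagier calculus of moves: for rational `x, y` the two pinned representations

* `U = [(0,1)², 4 σ^{2x-1} τ^{2x} ((1-σ²)(1-τ²))^{y-1}]` (value `B(x,y)·B(x+½,y)` after `s = σ²`, `t = τ²`),
* `W = [(0,1)², 4 p^{2x-1} (1-p)^{2y-1} (1-w²)^{y-1}]` (value `4·B(2x,2y)·½B(½,y)` before `v = w²`)

are `KZ.Equivalent` (`stub_quadCore`). Chain of moves (rules (1), (2) of Kontsevich–Zagier 2001 §1.2 only):

1. `QuadStep.wedge_fold`: drop the null diagonal (`IntegralRep.of_sub_of_restrict_mem_relations`), split the box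
   into the two open wedges (rule 1a), carry the lower wedge onto the upper one by the coordinate swap
   (`KZ.of_sub_of_reindex_mem_relations`, rule 2) and add the two integrands on the upper wedge (rule 1b):
   `U ∼ S = [{0<σ<τ<1}, 4 (στ)^{2x-1} (σ+τ) ((1-σ²)(1-τ²))^{y-1}]`;
2. `QuadStep.wedge_to_box`: the symmetric chart `(σ,τ) ↦ (στ, τ-σ)` of part 1 (`stub_quadSymChart`, Jacobian
   `σ + τ`, `(1-στ)² - (τ-σ)² = (1-σ²)(1-τ²)`) carries `S` onto the simplex representation
   `T = [{p>0, m>0, p+m<1}, 4 p^{2x-1} ((1-p)²-m²)^{y-1}]` (rule 2), and the linear Dirichlet chart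
   `(t,u) ↦ (u,(1-u)t)` of `KZDirichletCharts` (`KZ.exists_dirichletLinearChart`, Jacobian `1-u`) followed by the
   coordinate swap carries `T` onto `W` (rule 2 twice).

All intermediate representations are constructed here (semialgebraic Euler–Mellin integrands,
`KZ.isSemialgebraicFunOn_mellinIntegrand`; integrability by addition resp. by Mathlib's Jacobian criterion
`integrableOn_image_iff_integrableOn_abs_det_fderiv_smul`). Everything is proved; no `def`, no named fact.

References: Kontsevich–Zagier 2001 §1.2; Andrews–Askey–Roy 1999 Thm 3.1.3.
-/

noncomputable section

open MeasureTheory Set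
open Literature.ModelTheory.ExponentialFields (IsSemialgebraic)
open MvPolynomial (aeval X C)

namespace Summit.KontsevichZagierPeriods.FermatIsogeny.BetaProductSectorStubs

open Literature.NumberTheory.Transcendental
open Literature.NumberTheory.Transcendental.KZ

namespace QuadStep

/-! ## The wedges and the null diagonal

The upper wedge is `QuadStep.isSemialgebraic_wedge` (part 1); the lower wedge `{0 < τ < σ < 1}` is the
landed `GpcLegendreLemniscaticLine.fib_isSemialgebraic_tri` (reused, not restated). -/

/-- The open box minus the two open wedges lies in the diagonal `{σ = τ}`, a proper linear subspace, hence is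
Lebesgue-null (`Measure.addHaar_submodule`). [folklore] -/
theorem volume_box_diff_wedges :
    volume ({z : Fin 2 → ℝ | ∀ i, z i ∈ Set.Ioo (0:ℝ) 1} \
      ({z : Fin 2 → ℝ | 0 < z 0 ∧ z 0 < z 1 ∧ z 1 < 1} ∪ {z : Fin 2 → ℝ | 0 < z 1 ∧ z 1 < z 0 ∧ z 0 < 1})) = 0 := by
  set L : (Fin 2 → ℝ) →ₗ[ℝ] ℝ :=
    LinearMap.proj (R := ℝ) (φ := fun _ : Fin 2 => ℝ) 0 - LinearMap.proj (R := ℝ) (φ := fun _ : Fin 2 => ℝ) 1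
    with hL
  have hLapp : ∀ z : Fin 2 → ℝ, L z = z 0 - z 1 := fun z => by simp [hL]
  refine measure_mono_null (t := ((LinearMap.ker L : Submodule ℝ (Fin 2 → ℝ)) : Set (Fin 2 → ℝ))) ?_ ?_
  · rintro z ⟨hz, hzn⟩
    have h0 := hz 0
    have h1 := hz 1
    have heq : z 0 = z 1 := by
      rcases lt_trichotomy (z 0) (z 1) with h | h | h
      · exact absurd (Or.inl ⟨h0.1, h, h1.2⟩) hzn
      · exact h
      · exact absurd (Or.inr ⟨h1.1, h, h0.2⟩) hzn
    simp [hLapp, heq]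
  · refine Measure.addHaar_submodule volume _ fun htop => ?_
    have hmem : (![1, 0] : Fin 2 → ℝ) ∈ LinearMap.ker L := htop ▸ Submodule.mem_top
    rw [LinearMap.mem_ker, hLapp] at hmem
    simp at hmem

/-! ## The symmetrised integrand on the wedge and the simplex integrand -/

/-- The symmetrised Euler–Mellin integrand `4 (στ)^{2x-1} (σ+τ) ((1-σ²)(1-τ²))^{y-1}` of the wedge, unfolded.
[folklore] -/
theorem mellin_wedge_apply (x y : ℚ) (z : Fin 2 → ℝ) :
    KZ.mellinIntegrand ![X 0 * X 1, X 0 + X 1, (1 - X 0 ^ 2) * (1 - X 1 ^ 2)] ![2 * x - 1, 1, y - 1] 4 z =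
      4 * ((z 0 * z 1) ^ (2 * (x:ℝ) - 1) * (z 0 + z 1) * ((1 - z 0 ^ 2) * (1 - z 1 ^ 2)) ^ ((y:ℝ) - 1)) := by
  rw [KZ.mellinIntegrand_apply, Fin.prod_univ_three]
  simp only [Matrix.cons_val_zero, Matrix.cons_val_one, Matrix.cons_val, map_mul, map_add, map_sub,
    map_pow, map_one, MvPolynomial.aeval_X]
  push_cast
  rw [Real.rpow_one]

/-- The simplex Euler–Mellin integrand `4 p^{2x-1} ((1-p)² - m²)^{y-1}`, unfolded. [folklore] -/
theorem mellin_simplex_apply (x y : ℚ) (w : Fin 2 → ℝ) :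
    KZ.mellinIntegrand ![X 0, (1 - X 0) ^ 2 - X 1 ^ 2] ![2 * x - 1, y - 1] 4 w =
      4 * ((w 0) ^ (2 * (x:ℝ) - 1) * ((1 - w 0) ^ 2 - (w 1) ^ 2) ^ ((y:ℝ) - 1)) := by
  rw [KZ.mellinIntegrand_apply, Fin.prod_univ_two]
  simp only [Matrix.cons_val_zero, Matrix.cons_val_one, map_sub, map_pow, map_one, MvPolynomial.aeval_X]
  push_cast
  ring

/-- The folding identity on the wedge: `f(σ,τ) + f(τ,σ)` for `f = 4 σ^{2x-1} τ^{2x} ((1-σ²)(1-τ²))^{y-1}` is the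
symmetrised integrand `4 (στ)^{2x-1} (σ+τ) ((1-σ²)(1-τ²))^{y-1}`. [folklore] -/
theorem quad_fold_identity (a b : ℝ) {s t : ℝ} (hs : 0 < s) (ht : 0 < t) :
    4 * s ^ (a - 1) * t ^ a * ((1 - s ^ 2) * (1 - t ^ 2)) ^ (b - 1) +
        4 * t ^ (a - 1) * s ^ a * ((1 - t ^ 2) * (1 - s ^ 2)) ^ (b - 1) =
      4 * ((s * t) ^ (a - 1) * (s + t) * ((1 - s ^ 2) * (1 - t ^ 2)) ^ (b - 1)) := by
  have es : s ^ a = s ^ (a - 1) * s := by rw [← Real.rpow_add_one hs.ne', sub_add_cancel]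
  have et : t ^ a = t ^ (a - 1) * t := by rw [← Real.rpow_add_one ht.ne', sub_add_cancel]
  rw [es, et, Real.mul_rpow hs.le ht.le, mul_comm (1 - t ^ 2) (1 - s ^ 2)]
  ring

/-- The pull-back identity of the linear Dirichlet chart `(t,u) ↦ (u, (1-u)t)` for the quadratic move:
`4 u^{2x-1} ((1-u)² - ((1-u)t)²)^{y-1} · (1-u) = 4 u^{2x-1} (1-u)^{2y-1} (1-t²)^{y-1}`. [folklore] -/
theorem quad_pullback_linear (a b : ℝ) {t u : ℝ} (ht1 : t < 1) (ht0 : 0 < t) (hu1 : u < 1) :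
    4 * (u ^ (a - 1) * ((1 - u) ^ 2 - ((1 - u) * t) ^ 2) ^ (b - 1)) * (1 - u) =
      4 * u ^ (a - 1) * (1 - u) ^ (2 * b - 1) * (1 - t ^ 2) ^ (b - 1) := by
  have h1u : 0 < 1 - u := by linarith
  have h1t : 0 ≤ 1 - t ^ 2 := by nlinarith
  have e : (1 - u) ^ 2 - ((1 - u) * t) ^ 2 = (1 - u) ^ 2 * (1 - t ^ 2) := by ring
  have hu' : (1 - u) ^ (2 * b - 1) = ((1 - u) ^ 2) ^ (b - 1) * (1 - u) := by
    rw [show (2 * b - 1 : ℝ) = 2 * (b - 1) + 1 by ring, Real.rpow_add_one h1u.ne', Real.rpow_mul h1u.le,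
      Real.rpow_two]
  rw [e, Real.mul_rpow (sq_nonneg _) h1t, hu']
  ring

/-! ## Step 1: folding the box onto the wedge -/

/-- **Folding** (rules (1a), (2), (1b)): a representation pinned as
`U = [(0,1)², 4 σ^{2x-1} τ^{2x} ((1-σ²)(1-τ²))^{y-1}]` is equivalent to a representation pinned as
`S = [{0<σ<τ<1}, 4 (στ)^{2x-1} (σ+τ) ((1-σ²)(1-τ²))^{y-1}]`, WHICH EXISTS: discard the null diagonal, split into the
two wedges, reflect the lower wedge onto the upper one by the coordinate swap, add the integrands.
[cite: KontsevichZagier2001, §1.2 rule (1)] -/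
theorem wedge_fold (x y : ℚ) (U : KZ.IntegralRep 2)
    (hUd : U.domain = {z | ∀ i, z i ∈ Set.Ioo (0:ℝ) 1})
    (hUi : Set.EqOn U.integrand (fun z => 4 * (z 0) ^ (2 * (x:ℝ) - 1) * (z 1) ^ (2 * (x:ℝ)) *
      ((1 - z 0 ^ 2) * (1 - z 1 ^ 2)) ^ ((y:ℝ) - 1)) U.domain) :
    ∃ S : KZ.IntegralRep 2, S.domain = {z | 0 < z 0 ∧ z 0 < z 1 ∧ z 1 < 1} ∧
      Set.EqOn S.integrand (fun z => 4 * ((z 0 * z 1) ^ (2 * (x:ℝ) - 1) * (z 0 + z 1) *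
        ((1 - z 0 ^ 2) * (1 - z 1 ^ 2)) ^ ((y:ℝ) - 1))) S.domain ∧
      KZ.Equivalent U S := by
  set H : Set (Fin 2 → ℝ) := {z | 0 < z 0 ∧ z 0 < z 1 ∧ z 1 < 1} with hH
  set H' : Set (Fin 2 → ℝ) := {z | 0 < z 1 ∧ z 1 < z 0 ∧ z 0 < 1} with hH'
  have hHs : IsSemialgebraic ℚ H := isSemialgebraic_wedge
  have hH's : IsSemialgebraic ℚ H' :=
    Summit.KontsevichZagierPeriods.Grothendieck.GpcLegendreLemniscaticLine.fib_isSemialgebraic_tri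
  have hHU : H ⊆ U.domain := by
    rw [hUd]
    rintro z ⟨h0, h1, h2⟩
    exact Fin.forall_fin_two.2 ⟨⟨h0, by linarith⟩, ⟨by linarith, h2⟩⟩
  have hH'U : H' ⊆ U.domain := by
    rw [hUd]
    rintro z ⟨h0, h1, h2⟩
    exact Fin.forall_fin_two.2 ⟨⟨by linarith, h2⟩, ⟨h0, by linarith⟩⟩
  have hHH'U : H ∪ H' ⊆ U.domain := union_subset hHU hH'U
  have hnull : volume (U.domain \ (H ∪ H')) = 0 := by
    rw [hUd]
    exact volume_box_diff_wedges
  -- (1a) discard the diagonal and split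
  set U₁ : KZ.IntegralRep 2 := U.restrict (H ∪ H') (hHs.union hH's) hHH'U with hU₁
  have rel₁ : of U - of U₁ ∈ relations := U.of_sub_of_restrict_mem_relations _ hHH'U hnull
  set UH : KZ.IntegralRep 2 := U.restrict H hHs hHU with hUH
  set UH' : KZ.IntegralRep 2 := U.restrict H' hH's hH'U with hUH'
  have hdisj : H ∩ H' = ∅ := by
    ext z
    simp only [mem_inter_iff, mem_empty_iff_false, iff_false]
    rintro ⟨⟨_, h1, _⟩, ⟨_, h2, _⟩⟩
    linarith
  have rel₂ : of U₁ - of UH - of UH' ∈ relations :=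
    domainAddRel_subset_relations ⟨2, U₁, UH, UH', rfl,
      by rw [KZ.IntegralRep.domain_restrict, KZ.IntegralRep.domain_restrict, hdisj, measure_empty],
      fun _ _ => rfl, fun _ _ => rfl, rfl⟩
  -- (2) the coordinate swap carries the lower wedge onto the upper one
  set V : KZ.IntegralRep 2 := UH'.reindex (Equiv.swap (0 : Fin 2) 1) with hV
  have rel₃ : of UH' - of V ∈ relations := of_sub_of_reindex_mem_relations _ _
  have hVd : V.domain = H := by
    ext z
    simp only [hV, hUH', KZ.IntegralRep.reindex_domain, KZ.IntegralRep.domain_restrict, mem_setOf_eq,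
      Equiv.swap_apply_left, Equiv.swap_apply_right, hH, hH']
  have hVi : ∀ z ∈ H, V.integrand z = 4 * (z 1) ^ (2 * (x:ℝ) - 1) * (z 0) ^ (2 * (x:ℝ)) *
      ((1 - z 1 ^ 2) * (1 - z 0 ^ 2)) ^ ((y:ℝ) - 1) := by
    intro z hz
    have hz' : (fun i => z (Equiv.swap (0 : Fin 2) 1 i)) ∈ U.domain := hH'U hz
    rw [hV, KZ.IntegralRep.reindex_integrand]
    simp only [hUH', KZ.IntegralRep.integrand_restrict]
    rw [hUi hz']
    simp only [Equiv.swap_apply_left, Equiv.swap_apply_right]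
  -- (1b) the symmetrised representation on the wedge
  have hpos : ∀ z ∈ H, ∀ k, 0 < aeval z
      ((![X 0 * X 1, X 0 + X 1, (1 - X 0 ^ 2) * (1 - X 1 ^ 2)] : Fin 3 → MvPolynomial (Fin 2) ℚ) k) := by
    rintro z ⟨h0, h1, h2⟩ k
    have hz1 : 0 < z 1 := by linarith
    have hs0 : 0 < 1 - z 0 ^ 2 := by nlinarith
    have hs1 : 0 < 1 - z 1 ^ 2 := by nlinarith
    fin_cases k
    · simpa using mul_pos h0 hz1
    · simpa using (by linarith : 0 < z 0 + z 1)
    · simpa using mul_pos hs0 hs1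
  have hsum : ∀ z ∈ H, UH.integrand z + V.integrand z =
      KZ.mellinIntegrand ![X 0 * X 1, X 0 + X 1, (1 - X 0 ^ 2) * (1 - X 1 ^ 2)] ![2 * x - 1, 1, y - 1] 4 z := by
    intro z hz
    have h0 : 0 < z 0 := hz.1
    have h1 : 0 < z 1 := by linarith [hz.1, hz.2.1]
    rw [mellin_wedge_apply, hVi z hz]
    simp only [hUH, KZ.IntegralRep.integrand_restrict]
    rw [hUi (hHU hz)]
    exact quad_fold_identity _ _ h0 h1
  have hint : IntegrableOn
      (KZ.mellinIntegrand ![X 0 * X 1, X 0 + X 1, (1 - X 0 ^ 2) * (1 - X 1 ^ 2)] ![2 * x - 1, 1, y - 1] 4) H := by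
    have h1 : IntegrableOn UH.integrand H := UH.integrableOn
    have h2 : IntegrableOn V.integrand H := hVd ▸ V.integrableOn
    exact (h1.add h2).congr_fun (fun z hz => hsum z hz) hHs.measurableSet_holds
  let S : KZ.IntegralRep 2 := ⟨H, _, hHs, KZ.isSemialgebraicFunOn_mellinIntegrand hHs _ _ 4 hpos, hint⟩
  have rel₄ : of S - of UH - of V ∈ relations :=
    integrandAddRel_subset_relations ⟨2, S, UH, V, rfl, hVd, fun z hz => (hsum z hz).symm, rfl⟩
  refine ⟨S, rfl, fun z _ => mellin_wedge_apply x y z, ?_⟩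
  have e : of U - of S = (of U - of U₁) + (of U₁ - of UH - of UH') + (of UH' - of V) - (of S - of UH - of V) := by
    abel
  show of U - of S ∈ relations
  rw [e]
  exact relations.sub_mem (relations.add_mem (relations.add_mem rel₁ rel₂) rel₃) rel₄

/-! ## Step 2: from the wedge to the box through the simplex -/

/-- **Wedge to box** (rule (2) three times): a representation pinned as
`S = [{0<σ<τ<1}, 4 (στ)^{2x-1} (σ+τ) ((1-σ²)(1-τ²))^{y-1}]` is equivalent to a representation pinned as
`W = [(0,1)², 4 p^{2x-1} (1-p)^{2y-1} (1-w²)^{y-1}]`: the symmetric chart `(σ,τ) ↦ (στ, τ-σ)` onto the simplex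
representation `[{p>0,m>0,p+m<1}, 4 p^{2x-1}((1-p)²-m²)^{y-1}]` (which EXISTS, its integrability transported from
`W`), then the linear Dirichlet chart `(t,u) ↦ (u,(1-u)t)` and the coordinate swap.
[cite: KontsevichZagier2001, §1.2 rule (2)] -/
theorem wedge_to_box (x y : ℚ) (S W : KZ.IntegralRep 2)
    (hSd : S.domain = {z | 0 < z 0 ∧ z 0 < z 1 ∧ z 1 < 1})
    (hSi : Set.EqOn S.integrand (fun z => 4 * ((z 0 * z 1) ^ (2 * (x:ℝ) - 1) * (z 0 + z 1) *
      ((1 - z 0 ^ 2) * (1 - z 1 ^ 2)) ^ ((y:ℝ) - 1))) S.domain)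
    (hWd : W.domain = {z | ∀ i, z i ∈ Set.Ioo (0:ℝ) 1})
    (hWi : Set.EqOn W.integrand (fun z => 4 * (z 0) ^ (2 * (x:ℝ) - 1) * (1 - z 0) ^ (2 * (y:ℝ) - 1) *
      (1 - z 1 ^ 2) ^ ((y:ℝ) - 1)) W.domain) :
    KZ.Equivalent S W := by
  obtain ⟨Φ, Φ', hΦ0, hΦ1, hsa, hderiv, hinj, himage, hdet⟩ := stub_quadSymChart
  obtain ⟨Ψ, Ψ', hΨ0, hΨ1, hsaΨ, hderivΨ, hinjΨ, himageΨ, hdetΨ⟩ := KZ.exists_dirichletLinearChart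
  -- the swapped target `W'`, pinned on the box in the two-coordinate spelling
  set W' : KZ.IntegralRep 2 := W.reindex (Equiv.swap (0 : Fin 2) 1) with hW'
  have relW : of W - of W' ∈ relations := of_sub_of_reindex_mem_relations _ _
  have hW'd : W'.domain = {z : Fin 2 → ℝ | z 0 ∈ Set.Ioo (0:ℝ) 1 ∧ z 1 ∈ Set.Ioo (0:ℝ) 1} := by
    ext z
    simp only [hW', KZ.IntegralRep.reindex_domain, hWd, mem_setOf_eq, Fin.forall_fin_two,
      Equiv.swap_apply_left, Equiv.swap_apply_right]
    exact and_comm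
  have hW'i : ∀ z ∈ {z : Fin 2 → ℝ | z 0 ∈ Set.Ioo (0:ℝ) 1 ∧ z 1 ∈ Set.Ioo (0:ℝ) 1},
      W'.integrand z = 4 * (z 1) ^ (2 * (x:ℝ) - 1) * (1 - z 1) ^ (2 * (y:ℝ) - 1) *
        (1 - z 0 ^ 2) ^ ((y:ℝ) - 1) := by
    intro z hz
    have hz' : (fun i => z (Equiv.swap (0 : Fin 2) 1 i)) ∈ W.domain := by
      rw [hWd]
      exact Fin.forall_fin_two.2 ⟨by simpa using hz.2, by simpa using hz.1⟩
    rw [hW', KZ.IntegralRep.reindex_integrand]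
    simp only
    rw [hWi hz']
    simp only [Equiv.swap_apply_left, Equiv.swap_apply_right]
  -- the pull-back of the simplex integrand along the linear chart is `W'`
  have hpull : ∀ z ∈ {z : Fin 2 → ℝ | z 0 ∈ Set.Ioo (0:ℝ) 1 ∧ z 1 ∈ Set.Ioo (0:ℝ) 1},
      W'.integrand z =
        KZ.mellinIntegrand ![X 0, (1 - X 0) ^ 2 - X 1 ^ 2] ![2 * x - 1, y - 1] 4 (Ψ z) * |(Ψ' z).det| := by
    intro z hz
    rw [hW'i z hz, hdetΨ z hz, mellin_simplex_apply, hΨ0, hΨ1]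
    exact (quad_pullback_linear _ _ hz.1.2 hz.1.1 hz.2.2).symm
  -- the simplex representation `T` exists
  have hposT : ∀ w ∈ {z : Fin 2 → ℝ | 0 < z 0 ∧ 0 < z 1 ∧ z 0 + z 1 < 1}, ∀ k, 0 < aeval w
      ((![X 0, (1 - X 0) ^ 2 - X 1 ^ 2] : Fin 2 → MvPolynomial (Fin 2) ℚ) k) := by
    rintro w ⟨h0, h1, h2⟩ k
    fin_cases k
    · simpa using h0
    · have e : (1 - w 0) ^ 2 - w 1 ^ 2 = (1 - w 0 - w 1) * (1 - w 0 + w 1) := by ring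
      simpa [e] using mul_pos (by linarith : 0 < 1 - w 0 - w 1) (by linarith : 0 < 1 - w 0 + w 1)
  have hintT : IntegrableOn (KZ.mellinIntegrand ![X 0, (1 - X 0) ^ 2 - X 1 ^ 2] ![2 * x - 1, y - 1] 4)
      {z : Fin 2 → ℝ | 0 < z 0 ∧ 0 < z 1 ∧ z 0 + z 1 < 1} := by
    rw [← himageΨ, integrableOn_image_iff_integrableOn_abs_det_fderiv_smul volume KZ.measurableSet_box2
      (fun z _ => (hderivΨ z).hasFDerivWithinAt) hinjΨ]
    have h1 : IntegrableOn W'.integrand {z : Fin 2 → ℝ | z 0 ∈ Set.Ioo (0:ℝ) 1 ∧ z 1 ∈ Set.Ioo (0:ℝ) 1} :=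
      hW'd ▸ W'.integrableOn
    refine h1.congr_fun (fun z hz => ?_) KZ.measurableSet_box2
    rw [hpull z hz, smul_eq_mul, mul_comm]
  let T : KZ.IntegralRep 2 := ⟨{z : Fin 2 → ℝ | 0 < z 0 ∧ 0 < z 1 ∧ z 0 + z 1 < 1}, _,
    KZ.isSemialgebraic_simplex2, KZ.isSemialgebraicFunOn_mellinIntegrand KZ.isSemialgebraic_simplex2 _ _ 4 hposT,
    hintT⟩
  -- rule (2) along the linear chart: `W' ∼ T`
  have relΨ : of W' - of T ∈ relations :=
    changeOfVariablesRel_subset_relations ⟨2, W', T, Ψ, Ψ', by rw [hW'd]; exact hsaΨ,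
      fun z _ => (hderivΨ z).hasFDerivWithinAt, by rw [hW'd]; exact hinjΨ, by rw [hW'd]; exact himageΨ.symm,
      fun z hz => hpull z (by rw [hW'd] at hz; exact hz), rfl⟩
  -- rule (2) along the symmetric chart: `S ∼ T`
  have relΦ : of S - of T ∈ relations := by
    refine changeOfVariablesRel_subset_relations ⟨2, S, T, Φ, Φ', by rw [hSd]; exact hsa,
      fun z _ => (hderiv z).hasFDerivWithinAt, by rw [hSd]; exact hinj, by rw [hSd]; exact himage.symm,
      fun z hz => ?_, rfl⟩
    have hz' : z ∈ {z : Fin 2 → ℝ | 0 < z 0 ∧ z 0 < z 1 ∧ z 1 < 1} := by rw [hSd] at hz; exact hz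
    rw [hSi hz, hdet z hz']
    show _ = KZ.mellinIntegrand ![X 0, (1 - X 0) ^ 2 - X 1 ^ 2] ![2 * x - 1, y - 1] 4 (Φ z) * (z 0 + z 1)
    rw [mellin_simplex_apply, hΦ0, hΦ1, quad_key_identity]
    ring
  have e : of S - of W = (of S - of T) - (of W' - of T) - (of W - of W') := by abel
  show of S - of W ∈ relations
  rw [e]
  exact relations.sub_mem (relations.sub_mem relΦ relΨ) relW

end QuadStep

open QuadStep in
/-- **Stub `stub_quadCore` — the two-dimensional core of the quadratic move QUAD**: for rational `x, y` the pinned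
representations `[(0,1)², 4 σ^{2x-1} τ^{2x} ((1-σ²)(1-τ²))^{y-1}]` (value `B(x,y)B(x+½,y)`) and
`[(0,1)², 4 p^{2x-1} (1-p)^{2y-1} (1-w²)^{y-1}]` (value `2B(2x,2y)B(½,y)`) are equivalent in the Kontsevich–Zagier
calculus: fold the box onto the wedge `{σ<τ}` by the coordinate swap (`QuadStep.wedge_fold`), then pass through
the simplex in the symmetric functions `(στ, τ-σ)` and the linear Dirichlet chart (`QuadStep.wedge_to_box`). The
positivity hypotheses are not used by the moves (they only make the pinned representations exist).
[cite: AndrewsAskeyRoy1999, Thm 3.1.3] -/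
theorem stub_quadCore : ∀ (x y : ℚ), 0 < x → 0 < y → ∀ (U W : Literature.NumberTheory.Transcendental.KZ.IntegralRep 2), U.domain = {z | ∀ i, z i ∈ Set.Ioo (0:ℝ) 1} → Set.EqOn U.integrand (fun z => 4 * (z 0) ^ (2 * (x:ℝ) - 1) * (z 1) ^ (2 * (x:ℝ)) * ((1 - z 0 ^ 2) * (1 - z 1 ^ 2)) ^ ((y:ℝ) - 1)) U.domain → W.domain = {z | ∀ i, z i ∈ Set.Ioo (0:ℝ) 1} → Set.EqOn W.integrand (fun z => 4 * (z 0) ^ (2 * (x:ℝ) - 1) * (1 - z 0) ^ (2 * (y:ℝ) - 1) * (1 - z 1 ^ 2) ^ ((y:ℝ) - 1)) W.domain → Literature.NumberTheory.Transcendental.KZ.Equivalent U W := by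
  intro x y _ _ U W hUd hUi hWd hWi
  obtain ⟨S, hSd, hSi, hUS⟩ := wedge_fold x y U hUd hUi
  exact hUS.trans (wedge_to_box x y S W hSd hSi hWd hWi)

end Summit.KontsevichZagierPeriods.FermatIsogeny.BetaProductSectorStubs

end
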